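import Summits.BirchSwinnertonDyer.BirchSwinnertonDyer.Theorems.ThetaPartnerAtTwoSignedControlAtTwoCasselsPTModKummer
import Summits.BirchSwinnertonDyer.BirchSwinnertonDyer.Theorems.ThetaPartnerAtTwoSignedControlAtTwoCasselsLift
import Summits.BirchSwinnertonDyer.BirchSwinnertonDyer.Theorems.ThetaPartnerAtTwoSignedControlAtTwoCasselsBockstein
import Summits.BirchSwinnertonDyer.BirchSwinnertonDyer.Theorems.ThetaPartnerAtTwoSignedControlAtTwoCasselsLocalTerms
import Literature.NumberTheory.EllipticCurves.Greenberg1999.CasselsSurjectivityH1Sigma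
import Literature.NumberTheory.EllipticCurves.WeilPairingProofs
import HarnessLib

/-!
# CASSELS' THEOREM FROM POITOU–TATE: `Greenberg1999.casselsSurjectivity_H1Sigma K` for every number field `K`
# (in `Type`) from the tree's canonical duality fact `GaloisCohomology.poitouTate_selmerStructure_duality K`

Crux K4 `SignedControlAtTwo` (stmt-BirchSwinnertonDyer-20309; routes `ThetaPartnerAtTwo` /
`ResidualThetaTransportAtTwo`), line `eulerchar` v10 (`Cruxes/SignedControlAtTwo/Lines/eulerchar.lean`): the ONE stub
`stub_pubGreenbergPTTwo = casselsSurjectivity_H1Sigma ℚ ∧ prop412_noFiniteSubmodule_H1Sigma_of_rank_one ∧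
poitouTate_selmerStructure_duality ℚ`. This file proves that the FIRST conjunct follows from the THIRD (for every number
field `K : Type`), so that K4's residue of record becomes {Poitou–Tate for Selmer structures over `ℚ` (Milne I 4.10 /
Howard 2.1.11, a named fact owned by the Poitou–Tate lanes), Greenberg's Prop. 4.12 (`PROP412-SCOPING.md`)}. Width seat
`prover-bsd-wall-tp2-p3-w3` g6; plan `Cruxes/SignedControlAtTwo/CASSELS-VIA-PT-PLAN.md` (w3 g4), executed in a
SINGLE-LEVEL form (no Weil-pairing level compatibility is needed).

## The proof (Greenberg, LNM 1716, Prop. 4.13 and p. 121–122: «if `S_{M*}(F)` is finite and `M*(F) = 0`, then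
## `coker(γ) = 0`»; Cassels 1964; Milne I Thm. 6.13 / Lemma 6.15)

Data: `x_v ∈ 𝒫_E(K_v) = H¹(K_v, E(K̄_v))[p^∞]` for the finite `v ∈ Σ_f = S₀ ∪ {v ∣ p}` and the infinite `w`;
`Sel_{p^∞}(E/K)` finite; `E(K)[p^∞] = 0`.
1. Exponents: `p^n` kills the finitely many given classes; `p^e` kills the `p^∞`-Selmer group RELAXED AT `∞`
   (finite: `CasselsLift.finite_iInf_selmerLocalKerPrimary`); level `N = p^k`, `k = n + 1 + e`.
2. Kummer lifts `t_v ∈ H¹(K_v, E[N])` of the `x_v` (tree `exists_map_torsionPointsMapIntertwining_eq_of_zsmul_eq_zero`).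
3. Poitou–Tate (the CITED fact, level `N`) modulo the Kummer conditions (`CasselsPTModKummer`): `loc_v ξ − t_v ∈ 𝓛_v`
   on `Σ = Σ_f ∪ ∞` for some `ξ ∈ H¹(K, E[N])` Kummer outside `Σ`, PROVIDED `∑_{v∈Σ} inv_v(t_v ∪ₑ loc_v c) = 0` for every
   test class `c` (Kummer at the finite places, and at the infinite `w` with `inv_w` injective).
4. The obstruction vanishes TERM BY TERM: `ι_* c` is Selmer relaxed at `∞`, so `p^e c = 0` (`ι_*` injective as
   `E(K)[p^∞] = 0`, tree `torsionPowToPrimaryH1_injective`); hence `c = ι_* z`, `z ∈ H¹(K, E[p^e])`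
   (`CasselsBockstein`, again `E(K)[p^∞] = 0`); at each `v ∈ Σ` with `loc_v c ∈ 𝓛_v`:
   `loc_v c = p^{n+1} • κ_N(R_v)` (`CasselsLocalTerms`), and `inv_v(t_v ∪ₑ p^{n+1} κ_N(R_v)) = inv_v((p^{n+1} t_v) ∪ₑ κ_N(R_v)) = 0`
   by the isotropy of `𝓛_v` (`p^{n+1} t_v ∈ 𝓛_v` as it lifts `p^{n+1} x_v = 0`); at a real `w` either `inv_w = 0` or
   `inv_w` is injective (`CasselsArchH2`), and in the latter case `loc_w c ∈ 𝓛_w` is granted.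
5. `y = res_⊤ ι_* ξ ∈ H¹(⊤, E[p^∞])` is unramified outside `S₀ ∪ {v ∣ p}` (Kummer = unramified at good `v ∤ p`, tree
   `kummerSelmerStructure_inr_eq_unramifiedSubgroup`; `CasselsLift.res_torsionPowToPrimaryH1_mem_unramifiedKer`) and has
   the prescribed local restrictions (`CasselsLift.localResOver_top_res_torsionPowToPrimaryH1`).

THEOREMS ONLY; `casselsSurjectivity_H1Sigma_of_poitouTate` is CONDITIONAL on the named fact
`poitouTate_selmerStructure_duality K` (hypothesis) and on nothing else. BSD is not proved by any of this.

References: [GreenbergLNM1716] §4 Appendix, Prop. 4.13, pp. 120–123; [Cassels1964ArithmeticVII]; [MilneADT2006] I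
Thm. 4.10, Thm. 6.13, Lemma 6.15; [Howard2004HeegnerKolyvagin] Thm. 2.1.11; [SilvermanAEC2009] III.8.1, X.§4.
-/

set_option autoImplicit false
-- the Theorems namespace of this sub repeats the summit name by design (D-0017 nested layout)
set_option linter.dupNamespace false

noncomputable section

open scoped Classical

open CategoryTheory Field NumberField IsDedekindDomain Function WeierstrassCurve
open Literature.NumberTheory.EllipticCurves Literature.NumberTheory.EllipticCurves.GreenbergSelmer
open Literature.NumberTheory.GaloisRepresentations
open Literature.NumberTheory.GaloisRepresentations.DiscreteGaloisModule (SelmerStructure unramifiedSubgroup mu MuCarrier)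
open Literature.NumberTheory.GaloisCohomology
open scoped ContRepresentation

namespace Summit.BirchSwinnertonDyer.BirchSwinnertonDyer.Theorems.SignedEC.CasselsPT

open Summit.BirchSwinnertonDyer.Rank1Residual.X11b Summit.BirchSwinnertonDyer.Rank1Residual.X11b.KummerPT
open Summit.BirchSwinnertonDyer.Rank1Residual.X11b.LocBridge
open Summit.BirchSwinnertonDyer.Rank1Residual.X11b.Levels
open Summit.BirchSwinnertonDyer.Rank1Residual.X11b.AcSelmer
open Summit.BirchSwinnertonDyer.Rank1Residual.X11b.Relaxation

/-! ## §1 Small helpers -/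

section Helpers

variable {K : Type} [Field K] (W : WeierstrassCurve K) (p : ℕ)

/-- `E(K̄)[p^∞]^{Γ_K} = 0` from `#E(K̄)[p^∞]^{Γ_K} = 1` (the hypothesis `E(F)_p = 0` of Cassels' theorem as printed in
`casselsSurjectivity_H1Sigma`). [cite: GreenbergLNM1716, §4 Appendix, p. 122] -/
theorem forall_fixed_eq_zero_of_natCard_fixedPoints_eq_one
    (h : Nat.card (MulAction.fixedPoints (absoluteGaloisGroup K) (W.geomPrimaryTorsion p)) = 1)
    (a : W.geomPrimaryTorsion p) (ha : ∀ σ : absoluteGaloisGroup K, σ • a = a) : a = 0 := by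
  obtain ⟨hsub, -⟩ := Nat.card_eq_one_iff_unique.mp h
  have h0 : (0 : W.geomPrimaryTorsion p) ∈
      MulAction.fixedPoints (absoluteGaloisGroup K) (W.geomPrimaryTorsion p) := fun σ ↦ smul_zero σ
  exact congrArg Subtype.val (hsub.elim (⟨a, ha⟩ : MulAction.fixedPoints _ _) ⟨0, h0⟩)

/-- `E[p^M](K̄)^{Γ_K} = 0` when `E(K̄)[p^∞]^{Γ_K} = 0`. [cite: GreenbergLNM1716, §4 Appendix, p. 122] -/
theorem forall_fixed_geomTorsion_eq_zero (M : ℕ)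
    (hfix : ∀ a : W.geomPrimaryTorsion p, (∀ σ : absoluteGaloisGroup K, σ • a = a) → a = 0)
    (P : W.geomTorsion ((p ^ M : ℕ) : ℤ)) (hP : ∀ σ : absoluteGaloisGroup K, σ • P = P) : P = 0 := by
  have h := hfix (AddSubgroup.inclusion
    (Literature.Barriers.BirchSwinnertonDyer.geomTorsion_pow_le_geomPrimaryTorsion W p M) P) fun σ ↦ by
      apply Subtype.ext
      rw [Literature.NumberTheory.EllipticCurves.primaryComponent.coe_smul, AddSubgroup.coe_inclusion,
        ← Literature.NumberTheory.EllipticCurves.AddSubgroup.torsionBy.coe_smul, hP σ]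
  apply Subtype.ext
  have h' := congrArg Subtype.val h
  rwa [AddSubgroup.coe_inclusion] at h'

omit p in
/-- `p^i • a = 0` and `i ≤ j` give `p^j • a = 0`. [folklore] -/
theorem pow_nsmul_eq_zero_of_le {A : Type} [AddCommMonoid A] (q : ℕ) {i j : ℕ} (hij : i ≤ j) (a : A)
    (ha : q ^ i • a = 0) : q ^ j • a = 0 := by
  obtain ⟨d, rfl⟩ := Nat.exists_eq_add_of_le hij
  rw [pow_add, mul_comm, mul_smul, ha, smul_zero]

/-- If `z - t ∈ 𝓛_v` then `κ_v z = κ_v t` (`𝓛_v = ker κ_v`). [folklore] -/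
theorem map_torsionPointsMapIntertwining_eq_of_sub_mem [NumberField K] {n : ℤ} {v : Place K}
    {z t : galoisCohomology ((W.torsionGaloisModule n).toLocal v) 1} (h : z - t ∈ W.kummerSelmerStructure n v) :
    galoisCohomology.map (W.torsionPointsMapIntertwining n (Place.Completion v)) 1 z =
      galoisCohomology.map (W.torsionPointsMapIntertwining n (Place.Completion v)) 1 t := by
  have h' : galoisCohomology.map (W.torsionPointsMapIntertwining n (Place.Completion v)) 1 (z - t) = 0 := h
  exact sub_eq_zero.mp
    ((map_sub (galoisCohomology.map (W.torsionPointsMapIntertwining n (Place.Completion v)) 1) z t).symm.trans h')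

end Helpers

/-! ## §2 Cassels' theorem from Poitou–Tate -/

section Main

variable {K : Type} [Field K] [NumberField K]

/-- **CASSELS' THEOREM FROM POITOU–TATE** (Greenberg LNM 1716 Prop. 4.13 / p. 122 special case, every number field
`K : Type`, every prime `p`): GIVEN the tree's Poitou–Tate duality fact for Selmer structures
`GaloisCohomology.poitouTate_selmerStructure_duality K` (Milne I Thm. 4.10 + Howard Thm. 2.1.11, a named fact), if
`Sel_{p^∞}(E/K)` is finite and `E(K̄)[p^∞]^{Γ_K} = 0` then every family of `p`-power-torsion local classes
`x_v ∈ H¹(K_v, E(K̄_v))` on `Σ = S₀ ∪ {v ∣ p} ∪ ∞` (good reduction off `S₀ ∪ {v ∣ p}`) is the family of local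
restrictions of ONE class of `H¹(K_Σ/K, E[p^∞])` — `Greenberg1999.casselsSurjectivity_H1Sigma K` by name. See the module
docstring for the proof. CONDITIONAL on the named fact (hypothesis `hPT`); nothing else is assumed.
[cite: GreenbergLNM1716, §4 Appendix, Prop. 4.13 and p. 122] [cite: Cassels1964ArithmeticVII, Thm.]
[cite: MilneADT2006, Ch. I, Thm. 4.10, Thm. 6.13 and Lemma 6.15] -/
theorem casselsSurjectivity_H1Sigma_of_poitouTate (hPT : poitouTate_selmerStructure_duality K) :
    Greenberg1999.casselsSurjectivity_H1Sigma K := by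
  intro W _ p _ hSelFin hE0 S₀ hS₀fin hgood x xi hx hxi
  classical
  have hprime : p.Prime := Fact.out
  haveI : CompactSpace (absoluteGaloisGroup K) := absoluteGaloisGroup_compactSpace K
  -- (0) fixed points
  have hfix : ∀ a : W.geomPrimaryTorsion p, (∀ σ : absoluteGaloisGroup K, σ • a = a) → a = 0 :=
    forall_fixed_eq_zero_of_natCard_fixedPoints_eq_one W p hE0
  -- (1) the finite set `Σ_f = S₀ ∪ {v ∣ p}`
  have hp0 : (Ideal.span {((p : ℕ) : 𝓞 K)} : Ideal (𝓞 K)) ≠ 0 := by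
    rw [Ne, Ideal.zero_eq_bot, Ideal.span_singleton_eq_bot]
    exact_mod_cast hprime.ne_zero
  have hpfin : {v : HeightOneSpectrum (𝓞 K) | ((p : ℕ) : 𝓞 K) ∈ v.asIdeal}.Finite := by
    refine (Ideal.finite_factors hp0).subset fun v hv ↦ ?_
    exact (Ideal.dvd_span_singleton).mpr hv
  set Sf : Finset (HeightOneSpectrum (𝓞 K)) := (hS₀fin.union hpfin).toFinset with hSfdef
  have hSf : ∀ v : HeightOneSpectrum (𝓞 K), v ∈ Sf ↔ v ∈ S₀ ∨ ((p : ℕ) : 𝓞 K) ∈ v.asIdeal := fun v ↦ by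
    rw [hSfdef, Set.Finite.mem_toFinset, Set.mem_union, Set.mem_setOf_eq]
  -- the given classes in `H¹(Γ_{K_v}, E(K̄_v))` and a common exponent `p^n`
  choose kx hkx using hx
  choose ki hki using hxi
  choose a ha hpa using fun v : HeightOneSpectrum (𝓞 K) ↦
    exists_preimage_localSubgroup_top W p (v.adicCompletion K) (kx v) (x v) (hkx v)
  choose ai hai hpai using fun w : InfinitePlace K ↦
    exists_preimage_localSubgroup_top W p w.Completion (ki w) (xi w) (hki w)
  set n : ℕ := Sf.sup kx + Finset.univ.sup ki with hndef
  have han : ∀ v ∈ Sf, p ^ n • a v = 0 := fun v hv ↦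
    pow_nsmul_eq_zero_of_le p ((Finset.le_sup (f := kx) hv).trans (Nat.le_add_right _ _)) _ (hpa v)
  have hain : ∀ w : InfinitePlace K, p ^ n • ai w = 0 := fun w ↦
    pow_nsmul_eq_zero_of_le p ((Finset.le_sup (f := ki) (Finset.mem_univ w)).trans (Nat.le_add_left _ _)) _
      (hpai w)
  -- (2) the exponent `p^e` of the relaxed Selmer group
  set A : AddSubgroup (W.galH1Primary p) :=
    ⨅ v : HeightOneSpectrum (𝓞 K), selmerLocalKerPrimary W (v.adicCompletion K) p with hAdef
  haveI : Finite A := finite_iInf_selmerLocalKerPrimary W p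
  obtain ⟨e, he⟩ := exists_forall_pow_nsmul_eq_zero_of_finite W p A
  -- (3) the level `N = p ^ k`, `k = n + 1 + e`
  set k : ℕ := n + 1 + e with hkdef
  have hk : 0 < k := by omega
  haveI : NeZero (p ^ k) := ⟨pow_ne_zero k hprime.ne_zero⟩
  have hNz : ((p ^ k : ℕ) : ℤ) ≠ 0 := by exact_mod_cast pow_ne_zero k hprime.ne_zero
  have hez : ((p ^ e : ℕ) : ℤ) ≠ 0 := by exact_mod_cast pow_ne_zero e hprime.ne_zero
  have hdz : ((p ^ (n + 1) : ℕ) : ℤ) ≠ 0 := by exact_mod_cast pow_ne_zero (n + 1) hprime.ne_zero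
  have hlev : ((p ^ e : ℕ) : ℤ) * ((p ^ (n + 1) : ℕ) : ℤ) = ((p ^ k : ℕ) : ℤ) := by
    rw [hkdef]; push_cast; ring
  haveI : Finite (W.geomTorsion ((p ^ k : ℕ) : ℤ)) := finite_geomTorsion_of_neZero W _
  -- the Poitou–Tate family and the Weil pairing at level `N`
  obtain ⟨inv, hperf, -, -, hcompl⟩ := hPT (p ^ k)
  have hp2 : 2 ≤ p ^ k := le_trans hprime.two_le (Nat.le_self_pow hk.ne' p)
  have hchar : ((p ^ k : ℕ) : K) ≠ 0 := Nat.cast_ne_zero.mpr (pow_ne_zero _ hprime.ne_zero)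
  obtain ⟨ew, hμ, hadd₁, hadd₂, halt, hnondeg, hgal⟩ := W.exists_weilPairing_holds (p ^ k) hp2 hchar
  -- (4) Kummer lifts of the local classes to level `N`
  let b : Π v : Place K, discreteH1 (absoluteGaloisGroup (Place.Completion v)) (localPoints W (Place.Completion v)) :=
    fun v ↦ match v with
      | Sum.inl w => ai w
      | Sum.inr u => if u ∈ Sf then a u else 0
  have hbn : ∀ v : Place K, p ^ n • b v = 0 := by
    rintro (w | u)
    · exact hain w
    · by_cases hu : u ∈ Sf
      · simp only [b, if_pos hu]; exact han u hu
      · simp only [b, if_neg hu]; exact smul_zero _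
  have hbN : ∀ v : Place K, ((p ^ k : ℕ) : ℤ) • (b v : galoisCohomology (W.localGaloisModule (Place.Completion v)) 1) = 0 :=
    fun v ↦ by
      rw [natCast_zsmul]
      exact pow_nsmul_eq_zero_of_le p (show n ≤ k by omega) _ (hbn v)
  have hlift : ∀ v : Place K, ∃ t : galoisCohomology
      (GaloisRep.restrictField (Place.Completion v) (W.torsionGaloisModule ((p ^ k : ℕ) : ℤ))) 1,
      galoisCohomology.map (W.torsionPointsMapIntertwining ((p ^ k : ℕ) : ℤ) (Place.Completion v)) 1 t = b v := by
    intro v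
    haveI : CharZero (Place.Completion v) :=
      charZero_of_injective_algebraMap (algebraMap K (Place.Completion v)).injective
    exact W.exists_map_torsionPointsMapIntertwining_eq_of_zsmul_eq_zero (Place.Completion v) hNz _ (hbN v)
  choose t ht using hlift
  -- `p^{n+1} • t_v ∈ 𝓛_v`
  have htL : ∀ v : Place K, p ^ (n + 1) • t v ∈ W.kummerSelmerStructure ((p ^ k : ℕ) : ℤ) v := by
    intro v
    change galoisCohomology.map (W.torsionPointsMapIntertwining ((p ^ k : ℕ) : ℤ) (Place.Completion v)) 1
      (p ^ (n + 1) • t v) = 0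
    rw [map_nsmul, ht v]
    exact pow_nsmul_eq_zero_of_le p (Nat.le_succ n) _ (hbn v)
  -- (5) the set `Σ = ∞ ∪ Σ_f` and Poitou–Tate modulo the Kummer conditions
  set S' : Finset (Place K) := (Finset.univ.image Sum.inl) ∪ (Sf.image Sum.inr) with hS'def
  have hS'inr : ∀ u : HeightOneSpectrum (𝓞 K), (Sum.inr u : Place K) ∈ S' ↔ u ∈ Sf := fun u ↦ by
    simp only [hS'def, Finset.mem_union, Finset.mem_image, Finset.mem_univ, true_and, reduceCtorEq,
      exists_false, Sum.inr.injEq, exists_eq_right, false_or]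
  obtain ⟨ξ, hξout, hξS'⟩ := exists_mem_kummerOutside_localization_sub_mem W p k ew hμ hadd₁ hadd₂ hgal halt
    hnondeg hk hperf hcompl S' t (fun c hcfin hcinf ↦ by
      -- (4') the obstruction vanishes term by term
      -- `p^e • c = 0`
      have hcA : torsionPowToPrimaryH1 W p k c ∈ A :=
        torsionPowToPrimaryH1_mem_iInf_selmerLocalKerPrimary W p k c hcfin
      have hce' : torsionPowToPrimaryH1 W p k (p ^ e • c) = torsionPowToPrimaryH1 W p k 0 := by
        rw [map_zero]
        exact (map_nsmul (torsionPowToPrimaryH1 W p k) (p ^ e) c).trans (he _ hcA)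
      have hce : p ^ e • c = 0 := torsionPowToPrimaryH1_injective W p k hfix hce'
      -- `c = ι_* z`, `z ∈ H¹(K, E[p^e])`
      obtain ⟨z, rfl⟩ := exists_map_torsionInclusion_eq_of_nsmul_eq_zero_of_eq W (pow_ne_zero e hprime.ne_zero)
        hdz hlev (forall_fixed_geomTorsion_eq_zero W p e hfix) (Dvd.intro _ hlev) c hce
      refine Finset.sum_eq_zero fun v hv ↦ ?_
      -- the local term at `v` vanishes as soon as `loc_v c ∈ 𝓛_v`
      have key : galoisCohomology.localization (W.torsionGaloisModule ((p ^ k : ℕ) : ℤ)) v 1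
            (galoisCohomology.map (W.torsionInclusion (Dvd.intro _ hlev)) 1 z) ∈
            W.kummerSelmerStructure ((p ^ k : ℕ) : ℤ) v →
          invWeilPairing W (p ^ k) ew hμ hadd₁ hadd₂ hgal inv v (t v)
            (galoisCohomology.localization (W.torsionGaloisModule ((p ^ k : ℕ) : ℤ)) v 1
              (galoisCohomology.map (W.torsionInclusion (Dvd.intro _ hlev)) 1 z)) = 0 := by
        intro hmem
        haveI : CharZero (Place.Completion v) :=
          charZero_of_injective_algebraMap (algebraMap K (Place.Completion v)).injective
        rw [localization_map_one] at hmem ⊢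
        obtain ⟨R, hR, hEq⟩ := exists_eq_nsmul_localKummerClass_of_map_torsionInclusion_mem W
          (E := Place.Completion v) (p ^ (n + 1)) hlev hez hNz hmem
        rw [hEq]
        exact invWeilPairing_nsmul_eq_zero_of_nsmul_mem W (p ^ k) ew hμ hadd₁ hadd₂ hgal halt inv v (p ^ (n + 1))
          (htL v) (W.localKummerClass_mem_kummerLocalConditionAt _ hNz R hR)
      rcases v with w | u
      · -- an infinite place: `inv_w = 0` or `inv_w` injective
        rcases addMonoidHom_galoisCohomology_two_mu_inl_eq_zero_or_injective (p ^ k) w (inv (Sum.inl w)) with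
          h0 | hinj
        · rw [invWeilPairing_apply, h0, AddMonoidHom.zero_apply]
        · exact key (hcinf w hinj)
      · exact key (hcfin u))
  -- (6) the class `y = res_⊤ ι_* ξ`
  refine ⟨resH1Hom (Literature.NumberTheory.EllipticCurves.subgroupIncl (⊤ : Subgroup (absoluteGaloisGroup K)))
      (AddMonoidHom.id (W.geomPrimaryTorsion p)) (fun _ _ ↦ rfl) (torsionPowToPrimaryH1 W p k ξ), ?_, ?_, ?_⟩
  · -- unramified outside `S₀ ∪ {v ∣ p}`
    rw [GreenbergVatsal2000.mem_unramifiedOutside_iff]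
    intro v hvS₀ hvp σ
    rw [show Literature.NumberTheory.EllipticCurves.conjH1 ⊤ (W.geomPrimaryTorsion p) σ = AddMonoidHom.id _ from
      W.conjH1_of_mem_holds p ⊤ (Subgroup.mem_top σ), AddMonoidHom.id_apply]
    apply res_torsionPowToPrimaryH1_mem_unramifiedKer W p k ξ
    have hvSf : v ∉ Sf := fun h ↦ by
      rcases (hSf v).mp h with h | h
      · exact hvS₀ h
      · exact hvp h
    have hvS' : (Sum.inr v : Place K) ∉ S' := fun h ↦ hvSf ((hS'inr v).mp h)
    have hmem := (mem_kummerOutside_iff W (p ^ k) S' ξ).mp hξout (Sum.inr v) hvS'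
    rw [← kummerSelmerStructure_inr_eq_unramifiedSubgroup W p k hvp (hgood v hvS₀ hvp)]
    exact hmem
  · -- the finite places of `Σ`
    intro v hv
    have hvSf : v ∈ Sf := (hSf v).mpr hv
    have hvS' : (Sum.inr v : Place K) ∈ S' := (hS'inr v).mpr hvSf
    rw [localResOver_top_res_torsionPowToPrimaryH1 W p k (v.adicCompletion K) ξ, ← ha v]
    congr 1
    -- `κ_v(loc_v ξ) = κ_v(t_v) = a_v`
    have hsub := map_torsionPointsMapIntertwining_eq_of_sub_mem W (hξS' (Sum.inr v) hvS')
    rw [ht (Sum.inr v)] at hsub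
    have hb : b (Sum.inr v) = a v := by simp only [b, if_pos hvSf]
    exact hsub.trans hb
  · -- the infinite places
    intro w
    have hwS' : (Sum.inl w : Place K) ∈ S' := by
      simp only [hS'def, Finset.mem_union, Finset.mem_image, Finset.mem_univ, true_and, exists_apply_eq_apply,
        true_or]
    rw [localResOver_top_res_torsionPowToPrimaryH1 W p k w.Completion ξ, ← hai w]
    congr 1
    have hsub := map_torsionPointsMapIntertwining_eq_of_sub_mem W (hξS' (Sum.inl w) hwS')
    rw [ht (Sum.inl w)] at hsub
    exact hsub

end Main

end Summit.BirchSwinnertonDyer.BirchSwinnertonDyer.Theorems.SignedEC.CasselsPT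

end
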